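/-
Copyright: the b2b-balaban cell (near-miss cell 7), T⁴-continuum CRUX team (coordinator ruling e34b3e0c item (2)),
seat t4-ne7b-formalise-leaf-06 (gen 27). Released under the licence of the surrounding project.
-/
import Literature.MathematicalPhysics.QuantumFieldTheory.PolymerCombinatorics
import Literature.Computability.QuantumComplexity.SU2TorusGeometry
import HarnessLib

/-!
# No context-free small-field extension of one cube — kernel certificate of the refuter's witness F13
# (route NE7b R-H, prediction PH-c of `t4/ROUTES-NE7b.md`; `PRICING-NE7b.md` v3, F13)

Cell `pub-balaban`, sub-cell `t4`, spine estimate NE7b (node U5c), candidate route R-H «Peierls healing map»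
(`t4/ROUTES-NE7b.md` v2–v3.1, seat `t4-ne7b-idea-1`). Its step H3-birth was first cut (ROUTES v2, prediction
PH-c, «toy of H3b, one cube, elementary») as a CONTEXT-FREE Haar small-ball statement: for one unit cube `C`
with the exterior links frozen in a small-field configuration (every plaquette NOT meeting `C` below the
threshold), the Haar volume of {fibre `V⌈_C` : every plaquette MEETING `C` below the threshold} is
`≥ (c·ε³)^{#links(C)}`, uniformly in such exteriors. The refuter REFUTED this reading (PRICING-NE7b v3, F13) by a
four-link witness checked by hand. THIS FILE IS ITS KERNEL CERTIFICATE (second engine): `d = 4` (the `w = 0`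
slice of the `d = 3` witness), `G = SU(2)`, plaquette size = the operator-norm chord `‖1 − U(∂p)‖`, whose square
is `2 − Re tr U(∂p)` (`SU2ChordGeometry.norm_one_sub_coe_sq`) — the faithful `|U(∂p) − 1|`.

* `witness a`: identity on every link of `ℤ⁴` except `D(a) = diag(e^{ia}, e^{−ia})` on `s₇ = ((2,0,0,0), y)`,
  `s₅ = ((1,0,−1,0), z)` and `D(a)⁻¹` on `s₄ = ((1,1,−1,0), z)`, `s₆ = ((1,0,−1,0), y)`;
* `csq_plaquette_witness_le`: EVERY plaquette label of `ℤ⁴` not meeting `C = {0,1}⁴` has squared chord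
  `≤ 2 − 2cos a = ‖1 − D(a)‖²` (it carries at most one charged link: `wsum_of_not_meetsCube`, 16 direction pairs
  closed by `omega` on the four integer coordinates);
* `le_max_csq_P₁_P₂`: for EVERY configuration agreeing with the witness off the 32 fibre links, the plaquettes
  `P₁ = ((1,0,0,0); x,y)`, `P₂ = ((1,0,−1,0); y,z)` (faces `{z = 0}`, `{x = 1}` of `Q = [1,2]×[0,1]×[−1,0]×{0}`,
  both through the fibre link `f₀ = ((1,0,0,0), y)`, value `V`) have `max csq ≥ 2 − 2cos 2a = ‖1 − D(2a)‖²`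
  (`0 ≤ a ≤ π/4`): `U(∂P₁) = D(a)V⁻¹`, `tr U(∂P₂) = tr D(−3a)V⁻¹`, `tr D(a)M + tr D(−3a)M = 2cos(2a)·tr D(−a)M`,
  `|Re tr| ≤ 2` on `SU(2)` — F13's Bianchi / triangle-inequality step (tight: `V = D(a)⁻¹` gives equality);
* `smallField_extension_nogo`; `smallField_fibreSet_eq_empty` (thresholds `2 − 2cos a < t ≤ 2 − 2cos 2a`: exterior
  admissible WITH MARGIN, PH-c fibre set EMPTY); `measure_smallFieldEvent_eq_zero` (null for EVERY measure on the
  fibre space, product Haar included — not `≥ (cε³)^{32}`); `smallField_extension_nogo_eps` (every `0 < ε ≤ √2`: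
  exterior squared chords `≤ (3/10)ε²`, i.e. chord `< 0.55ε`, yet every completion has a plaquette meeting `C` of
  chord `≥ ε`). The witness's ratio is `2cos(a/2) → 2`; margins beyond a factor `2` are NOT addressed.

HONEST FRAMING. This certifies the refuter's «PH-c AS STATED: refuted-MISSTATED», nothing more: «exterior
plaquettes small» is NOT Bałaban's admissibility (B15 = CMP 122 (1989) p.178 (1.3): the small-field function of
a cube `□` bounds `sup_{p ⊂ □~}` of the local MINIMISER over the ENLARGED cube; (1.5)/(1.7) look one–two layers
into the would-be-healed region — the witness violates them for BOTH branches). The repaired statement PH-c⁺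
(«margin / interior-regularity lemma», PRICING v3 F13–F15) is OPEN and untouched. Nothing of [Bałaban 1983–89]
is asserted. NE7b (`T4WeightBudget.RelWeightBound`) is NOT PRINTED and NOT PROVED; spine PROVED 0∕9; rung (B)+1
on a FINITE torus T⁴ — NOT infinite volume, NOT the mass gap, NOT Clay. HONEST DEPENDENCY: continuum YM on T⁴ ⇐
BetaPertH ∧ nine spine estimates (0/9 proved); BetaPertH ⇐ (D1) ∧ (D4) ∧ CAP+tail; G-an2-4 gates asym, D1 and
NE2/3/4. POLICY: crux-route work under `Spine/NE7b/` (like `LocalPlaquetteExpMoments`, `HealingMap`), not a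
`T4Continuum/Support` leaf (FREEZE (0) respected); no `Prop`-valued fact, no `[cite:]` fact, no hypothesis
typing: two geometric sets, one explicit configuration, theorems.
-/

set_option autoImplicit false

noncomputable section

namespace Summit.QuantumFields.BalabanUV.T4Continuum.NE7b.SmallFieldExtensionNoGo

open scoped Matrix.Norms.L2Operator
open MeasureTheory
open Literature.MathematicalPhysics.QuantumFieldTheory (ZdEdge ZdGaugeConfig Plaq)
open Literature.Probability.LatticeModels (Site)
open Literature.Computability.QuantumComplexity (torus torus_add torus_neg torus_zero coe_torus trace_torus_re
  norm_one_sub_coe_sq abs_trace_re_le_two diagMatrix)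

/-! ## §1 `SU(2)` and the squared chord `‖1 − g‖² = 2 − Re tr g` -/

/-- The gauge group `SU(2)`. -/
abbrev SU2 : Type := ↥(Matrix.specialUnitaryGroup (Fin 2) ℂ)

/-- Squared chord size `2 − Re tr g` of `g ∈ SU(2)` (`= ‖1 − g‖²`, `csq_eq_norm_sq`): the transcription of
`|U(∂p) − 1|²` for a plaquette variable `U(∂p) = g`. -/
def csq (g : SU2) : ℝ := 2 - ((g : Matrix (Fin 2) (Fin 2) ℂ).trace).re

/-- `csq g = ‖1 − g‖²` (operator norm). -/
theorem csq_eq_norm_sq (g : SU2) : csq g = ‖(1 : Matrix (Fin 2) (Fin 2) ℂ) - (g : Matrix (Fin 2) (Fin 2) ℂ)‖ ^ 2 :=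
  (norm_one_sub_coe_sq g).symm

/-- `0 ≤ csq g ≤ 4`. -/
theorem csq_nonneg_le (g : SU2) : 0 ≤ csq g ∧ csq g ≤ 4 := by
  have h := abs_trace_re_le_two g
  rw [abs_le] at h
  unfold csq; constructor <;> linarith [h.1, h.2]

/-- `csq D(ψ) = 2 − 2cos ψ`. -/
theorem csq_torus (ψ : ℝ) : csq (torus ψ) = 2 - 2 * Real.cos ψ := by
  unfold csq; rw [trace_torus_re]

/-! ## §2 The cube `C = {0,1}⁴`, its fibre links, the plaquettes meeting it -/

/-- FIBRE LINKS: links of `ℤ⁴` with BOTH endpoints in `C = {0,1}⁴` (its 32 edges) — the variables `V⌈_C` of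
PH-c; all other links form the frozen EXTERIOR. -/
def fibre : Set (ZdEdge 4) := {e | (∀ k : Fin 4, e.1 k = 0 ∨ e.1 k = 1) ∧ e.1 e.2 = 0}

/-- PLAQUETTES MEETING `C`: labels `(x, i, j)` one of whose bonds `(x,i), (x+eᵢ,j), (x+eⱼ,i), (x,j)`
(`Plaq.bonds`) is a fibre link; the other labels are the EXTERIOR plaquettes (they do not see the fibre). -/
def meetsCube : Set (Plaq 4) := {p | ∃ e ∈ p.bonds, e ∈ fibre}

/-- `meetsCube` bond by bond. -/
theorem mem_meetsCube_iff (x : Site 4) (i j : Fin 4) :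
    (x, i, j) ∈ meetsCube ↔
      (x, i) ∈ fibre ∨ (x + Pi.single i 1, j) ∈ fibre ∨ (x + Pi.single j 1, i) ∈ fibre ∨ (x, j) ∈ fibre := by
  simp only [meetsCube, Set.mem_setOf_eq, Plaq.bonds, Finset.mem_insert, Finset.mem_singleton, exists_eq_or_imp,
    exists_eq_left]

/-- `∀ k : Fin 4` as a conjunction (for `omega`). -/
theorem forall_fin4 (P : Fin 4 → Prop) : (∀ k : Fin 4, P k) ↔ P 0 ∧ P 1 ∧ P 2 ∧ P 3 := by
  simp only [Fin.forall_fin_succ, Fin.isValue, Fin.succ_zero_eq_one, Fin.succ_one_eq_two, IsEmpty.forall_iff, and_true]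
  rfl

/-! ## §3 The witness exterior (F13) and its exterior plaquettes -/

/-- Charged link `s₇ = ((2,0,0,0), y)` (carries `D(a)`). -/ def s₇ : ZdEdge 4 := (![2, 0, 0, 0], 1)
/-- Charged link `s₅ = ((1,0,−1,0), z)` (carries `D(a)`). -/ def s₅ : ZdEdge 4 := (![1, 0, -1, 0], 2)
/-- Charged link `s₄ = ((1,1,−1,0), z)` (carries `D(a)⁻¹`). -/ def s₄ : ZdEdge 4 := (![1, 1, -1, 0], 2)
/-- Charged link `s₆ = ((1,0,−1,0), y)` (carries `D(a)⁻¹`). -/ def s₆ : ZdEdge 4 := (![1, 0, -1, 0], 1)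

open Classical in
/-- Integer charge of a link: `+1` on `s₇, s₅`, `−1` on `s₄, s₆`, `0` elsewhere (so `0` on the fibre). -/
def wexp (e : ZdEdge 4) : ℤ := if e = s₇ ∨ e = s₅ then 1 else if e = s₄ ∨ e = s₆ then -1 else 0

/-- THE WITNESS EXTERIOR `U₀(e) = D(wexp(e)·a)` (its values on the fibre links are immaterial). -/
def witness (a : ℝ) : ZdGaugeConfig 4 SU2 := fun e => torus ((wexp e : ℝ) * a)

/-- Net charge around the label `(x, i, j)`. -/
def wsum (x : Site 4) (i j : Fin 4) : ℤ :=
  wexp (x, i) + wexp (x + Pi.single i 1, j) - wexp (x + Pi.single j 1, i) - wexp (x, j)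

/-- `U₀(∂(x,i,j)) = D(wsum·a)`. -/
theorem plaquette_witness (a : ℝ) (x : Site 4) (i j : Fin 4) :
    ZdGaugeConfig.plaquette (witness a) x i j = torus ((wsum x i j : ℝ) * a) := by
  simp only [ZdGaugeConfig.plaquette, witness, wsum, ← torus_neg, ← torus_add]
  congr 1; push_cast; ring

/-- THE COMBINATORIAL HEART OF F13: a label NOT meeting `C` carries at most one charged link (any two of
`s₄, s₅, s₆` are coplanar only in the face `{x = 1}` of `Q`, `s₇` meets them only in `{z = 0}`, and both faces
contain the fibre link `f₀`), so its net charge is `0` or `±1`. -/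
theorem wsum_of_not_meetsCube (x : Site 4) (i j : Fin 4) (h : (x, i, j) ∉ meetsCube) :
    wsum x i j = 0 ∨ wsum x i j = 1 ∨ wsum x i j = -1 := by
  rw [mem_meetsCube_iff] at h
  have h4 : ∀ k : Fin 4, k = 0 ∨ k = 1 ∨ k = 2 ∨ k = 3 := by intro k; fin_cases k <;> simp
  rcases h4 i with rfl | rfl | rfl | rfl <;> rcases h4 j with rfl | rfl | rfl | rfl <;>
  simp only [wsum, wexp, s₄, s₅, s₆, s₇, fibre, Set.mem_setOf_eq, Prod.mk.injEq, funext_iff, forall_fin4,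
    Fin.isValue, Fin.reduceEq, Pi.add_apply, Pi.single_apply, if_true, if_false,
    Matrix.cons_val_zero, Matrix.cons_val_one, Matrix.cons_val_two, Matrix.cons_val, Matrix.head_cons,
    Matrix.tail_cons, and_true, and_false, or_false, false_or, add_zero] at h ⊢ <;>
  first | (split_ifs <;> omega) | omega

/-- EXTERIOR ADMISSIBILITY: every label not meeting `C` has squared chord `≤ 2 − 2cos a = ‖1 − D(a)‖²`. -/
theorem csq_plaquette_witness_le (a : ℝ) (x : Site 4) (i j : Fin 4) (h : (x, i, j) ∉ meetsCube) :
    csq (ZdGaugeConfig.plaquette (witness a) x i j) ≤ 2 - 2 * Real.cos a := by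
  rw [plaquette_witness, csq_torus]
  rcases wsum_of_not_meetsCube x i j h with h0 | h0 | h0 <;> rw [h0]
  · simp only [Int.cast_zero, zero_mul, Real.cos_zero]; linarith [Real.cos_le_one a]
  · simp only [Int.cast_one, one_mul, le_refl]
  · simp only [Int.cast_neg, Int.cast_one, neg_one_mul, Real.cos_neg, le_refl]

/-! ## §4 The two test plaquettes through the fibre link `f₀` -/

/-- The fibre link `f₀ = ((1,0,0,0), y)`. -/ def f₀ : ZdEdge 4 := (![1, 0, 0, 0], 1)
/-- `P₁ = ((1,0,0,0); x, y)`: bonds `((1,0,0,0),x)`, `s₇`, `((1,1,0,0),x)`, `f₀`. -/ def P₁ : Plaq 4 := (![1, 0, 0, 0], 0, 1)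
/-- `P₂ = ((1,0,−1,0); y, z)`: bonds `s₆`, `s₄`, `f₀`, `s₅`. -/ def P₂ : Plaq 4 := (![1, 0, -1, 0], 1, 2)

/-- `f₀` is a fibre link. -/
theorem f₀_mem_fibre : f₀ ∈ fibre := by
  simp [fibre, f₀, forall_fin4]

/-- `P₁` and `P₂` are genuine plaquettes (`i < j`) meeting `C` (through `f₀`). -/
theorem P₁_P₂_mem_meetsCube : (P₁.2.1 < P₁.2.2 ∧ P₁ ∈ meetsCube) ∧ (P₂.2.1 < P₂.2.2 ∧ P₂ ∈ meetsCube) := by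
  refine ⟨⟨by decide, ?_⟩, by decide, ?_⟩
  · rw [P₁, mem_meetsCube_iff]
    exact Or.inr (Or.inr (Or.inr f₀_mem_fibre))
  · rw [P₂, mem_meetsCube_iff]
    have e : (((![1, 0, -1, 0] : Site 4) + Pi.single 2 1, 1) : ZdEdge 4) = f₀ :=
      Prod.ext (by ext k; fin_cases k <;> simp [f₀]) rfl
    exact Or.inr (Or.inr (Or.inl (e ▸ f₀_mem_fibre)))

section Completion

variable {a : ℝ} {U : ZdGaugeConfig 4 SU2}

/-- A completion of the witness on the exterior bonds of `P₁`, `P₂`: `1, D(a), 1` and `D(a)⁻¹, D(a)⁻¹, D(a)`. -/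
theorem completion_values (hU : ∀ e, e ∉ fibre → U e = witness a e) :
    (U (![1, 0, 0, 0], 0) = 1 ∧ U (![2, 0, 0, 0], 1) = torus a ∧ U (![1, 1, 0, 0], 0) = 1) ∧
      U (![1, 0, -1, 0], 1) = torus (-a) ∧ U (![1, 1, -1, 0], 2) = torus (-a) ∧ U (![1, 0, -1, 0], 2) = torus a := by
  have key : ∀ e : ZdEdge 4, e ∉ fibre → ∀ n : ℤ, wexp e = n → U e = torus ((n : ℝ) * a) := by
    intro e he n hn; rw [hU e he, witness, hn]
  have nf : ((![1, 0, 0, 0], 0) : ZdEdge 4) ∉ fibre ∧ ((![2, 0, 0, 0], 1) : ZdEdge 4) ∉ fibre ∧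
      ((![1, 1, 0, 0], 0) : ZdEdge 4) ∉ fibre ∧ ((![1, 0, -1, 0], 1) : ZdEdge 4) ∉ fibre ∧
      ((![1, 1, -1, 0], 2) : ZdEdge 4) ∉ fibre ∧ ((![1, 0, -1, 0], 2) : ZdEdge 4) ∉ fibre := by
    simp [fibre, forall_fin4]
  have w : wexp (![1, 0, 0, 0], 0) = 0 ∧ wexp (![2, 0, 0, 0], 1) = 1 ∧ wexp (![1, 1, 0, 0], 0) = 0 ∧
      wexp (![1, 0, -1, 0], 1) = -1 ∧ wexp (![1, 1, -1, 0], 2) = -1 ∧ wexp (![1, 0, -1, 0], 2) = 1 := by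
    simp [wexp, s₄, s₅, s₆, s₇, funext_iff, forall_fin4]
  refine ⟨⟨?_, ?_, ?_⟩, ?_, ?_, ?_⟩
  · rw [key _ nf.1 0 w.1, Int.cast_zero, zero_mul, torus_zero]
  · rw [key _ nf.2.1 1 w.2.1, Int.cast_one, one_mul]
  · rw [key _ nf.2.2.1 0 w.2.2.1, Int.cast_zero, zero_mul, torus_zero]
  · rw [key _ nf.2.2.2.1 (-1) w.2.2.2.1, Int.cast_neg, Int.cast_one, neg_one_mul]
  · rw [key _ nf.2.2.2.2.1 (-1) w.2.2.2.2.1, Int.cast_neg, Int.cast_one, neg_one_mul]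
  · rw [key _ nf.2.2.2.2.2 1 w.2.2.2.2.2, Int.cast_one, one_mul]

/-- `U(∂P₁) = D(a)·V⁻¹` and `U(∂P₂) = D(a)⁻¹D(a)⁻¹·V⁻¹·D(a)⁻¹` for a completion `U`, `V = U(f₀)`. -/
theorem plaquette_P₁_P₂ (hU : ∀ e, e ∉ fibre → U e = witness a e) :
    ZdGaugeConfig.plaquette U P₁.1 P₁.2.1 P₁.2.2 = torus a * (U f₀)⁻¹ ∧
      ZdGaugeConfig.plaquette U P₂.1 P₂.2.1 P₂.2.2 = torus (-a) * torus (-a) * (U f₀)⁻¹ * (torus a)⁻¹ := by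
  obtain ⟨⟨h1, h2, h3⟩, h4, h5, h6⟩ := completion_values hU
  have e1 : (![1, 0, 0, 0] : Site 4) + Pi.single 0 1 = ![2, 0, 0, 0] := by ext k; fin_cases k <;> simp
  have e2 : (![1, 0, 0, 0] : Site 4) + Pi.single 1 1 = ![1, 1, 0, 0] := by ext k; fin_cases k <;> simp
  have e3 : (![1, 0, -1, 0] : Site 4) + Pi.single 1 1 = ![1, 1, -1, 0] := by ext k; fin_cases k <;> simp
  have e4 : (![1, 0, -1, 0] : Site 4) + Pi.single 2 1 = ![1, 0, 0, 0] := by ext k; fin_cases k <;> simp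
  constructor
  · simp only [ZdGaugeConfig.plaquette, P₁, e1, e2, h1, h2, h3, one_mul, inv_one, mul_one]; rfl
  · simp only [ZdGaugeConfig.plaquette, P₂, e3, e4, h4, h5, h6]; rfl

end Completion

/-! ## §5 The trace identity (Bianchi step) and the forced large plaquette -/

/-- `e^{iθ}`. -/
def cis (θ : ℝ) : ℂ := Complex.exp ((θ : ℂ) * Complex.I)

/-- `e^{i(s+t)} = e^{is} e^{it}`. -/
theorem cis_add (s t : ℝ) : cis (s + t) = cis s * cis t := by
  unfold cis; rw [← Complex.exp_add]; push_cast; ring_nf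

/-- `2cos c = e^{ic} + e^{−ic}`. -/
theorem two_cos_eq_cis_add_cis (c : ℝ) : ((2 * Real.cos c : ℝ) : ℂ) = cis c + cis (-c) := by
  unfold cis; push_cast
  rw [← Complex.cos_add_sin_I, neg_mul, ← neg_mul, ← Complex.cos_sub_sin_I]  -- noqa
  ring

/-- `tr(D(θ) M) = e^{iθ} M₀₀ + e^{−iθ} M₁₁`. -/
theorem trace_torus_mul (θ : ℝ) (M : Matrix (Fin 2) (Fin 2) ℂ) :
    (((torus θ : SU2) : Matrix (Fin 2) (Fin 2) ℂ) * M).trace = cis θ * M 0 0 + cis (-θ) * M 1 1 := by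
  rw [coe_torus]
  unfold diagMatrix cis
  rw [Matrix.trace_fin_two]
  simp [Matrix.mul_apply, Fin.sum_univ_two]

/-- THE IDENTITY `tr(D(a) M) + tr(D(−3a) M) = 2cos(2a)·tr(D(−a) M)` (`e^{ia} + e^{−3ia} = 2cos(2a)e^{−ia}`). -/
theorem trace_torus_add_trace_torus (a : ℝ) (M : Matrix (Fin 2) (Fin 2) ℂ) :
    (((torus a : SU2) : Matrix (Fin 2) (Fin 2) ℂ) * M).trace +
        (((torus (-(3 * a)) : SU2) : Matrix (Fin 2) (Fin 2) ℂ) * M).trace =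
      ((2 * Real.cos (2 * a) : ℝ) : ℂ) * ((((torus (-a)) : SU2) : Matrix (Fin 2) (Fin 2) ℂ) * M).trace := by
  rw [trace_torus_mul, trace_torus_mul, trace_torus_mul, two_cos_eq_cis_add_cis]
  simp only [neg_neg]
  have e1 : cis a = cis (2 * a) * cis (-a) := by rw [← cis_add]; congr 1; ring
  have e2 : cis (-(3 * a)) = cis (-(2 * a)) * cis (-a) := by rw [← cis_add]; congr 1; ring
  have e3 : cis (3 * a) = cis (2 * a) * cis a := by rw [← cis_add]; congr 1; ring
  have e4 : cis (-a) = cis (-(2 * a)) * cis a := by rw [← cis_add]; congr 1; ring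
  linear_combination (M 0 0) * e1 + (M 0 0) * e2 + (M 1 1) * e3 + (M 1 1) * e4

section Forced

variable {a : ℝ} {U : ZdGaugeConfig 4 SU2}

/-- THE BIANCHI STEP: `csq U(∂P₁) + csq U(∂P₂) = 4 − 2cos(2a)·Re tr(D(−a) V⁻¹)` for a completion `U`. -/
theorem csq_P₁_add_csq_P₂ (hU : ∀ e, e ∉ fibre → U e = witness a e) :
    csq (ZdGaugeConfig.plaquette U P₁.1 P₁.2.1 P₁.2.2) + csq (ZdGaugeConfig.plaquette U P₂.1 P₂.2.1 P₂.2.2) =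
      4 - 2 * Real.cos (2 * a) * ((((torus (-a) : SU2) : Matrix (Fin 2) (Fin 2) ℂ) *
        (((U f₀)⁻¹ : SU2) : Matrix (Fin 2) (Fin 2) ℂ)).trace).re := by
  obtain ⟨hP1, hP2⟩ := plaquette_P₁_P₂ hU
  rw [hP1, hP2]
  set V : SU2 := U f₀
  have hg : (torus a)⁻¹ * (torus (-a) * torus (-a) * V⁻¹) = torus (-(3 * a)) * V⁻¹ := by
    rw [← torus_neg, ← mul_assoc, ← mul_assoc, ← torus_add, ← torus_add]
    congr 2; ring
  have hcomm : ∀ X Y : SU2, ((X * Y : SU2) : Matrix (Fin 2) (Fin 2) ℂ).trace = ((Y * X : SU2) : Matrix (Fin 2) (Fin 2) ℂ).trace :=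
    fun X Y => by rw [Submonoid.coe_mul, Submonoid.coe_mul, Matrix.trace_mul_comm]
  have hcyc : (((torus (-a) * torus (-a) * V⁻¹ * (torus a)⁻¹ : SU2)) : Matrix (Fin 2) (Fin 2) ℂ).trace =
      (((torus (-(3 * a)) : SU2) : Matrix (Fin 2) (Fin 2) ℂ) * ((V⁻¹ : SU2) : Matrix (Fin 2) (Fin 2) ℂ)).trace := by
    rw [hcomm, hg, Submonoid.coe_mul]
  have hre := congrArg Complex.re (trace_torus_add_trace_torus a ((V⁻¹ : SU2) : Matrix (Fin 2) (Fin 2) ℂ))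
  rw [Complex.add_re, Complex.re_ofReal_mul] at hre
  unfold csq
  rw [hcyc, Submonoid.coe_mul]
  linarith

/-- THE FORCED LARGE PLAQUETTE: for `0 ≤ a ≤ π/4` and every completion `U` of the witness,
`max(csq U(∂P₁), csq U(∂P₂)) ≥ 2 − 2cos(2a) = ‖1 − D(2a)‖²`. -/
theorem le_max_csq_P₁_P₂ (ha₀ : 0 ≤ a) (ha : a ≤ Real.pi / 4) (hU : ∀ e, e ∉ fibre → U e = witness a e) :
    2 - 2 * Real.cos (2 * a) ≤
      max (csq (ZdGaugeConfig.plaquette U P₁.1 P₁.2.1 P₁.2.2)) (csq (ZdGaugeConfig.plaquette U P₂.1 P₂.2.1 P₂.2.2)) := by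
  have hsum := csq_P₁_add_csq_P₂ hU
  have hcos : 0 ≤ Real.cos (2 * a) :=
    Real.cos_nonneg_of_neg_pi_div_two_le_of_le (by linarith [Real.pi_pos]) (by linarith)
  have htr := abs_trace_re_le_two (torus (-a) * (U f₀)⁻¹)
  rw [Submonoid.coe_mul, abs_le] at htr
  have hprod := mul_le_mul_of_nonneg_left htr.2 (by positivity : (0 : ℝ) ≤ 2 * Real.cos (2 * a))
  rw [le_max_iff]
  by_contra hcon
  rw [not_or, not_le, not_le] at hcon
  linarith [hcon.1, hcon.2]

end Forced

/-! ## §6 The no-go theorems -/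

/-- **NO CONTEXT-FREE SMALL-FIELD EXTENSION OF ONE CUBE (F13 in the kernel).** For `0 ≤ a ≤ π/4` the exterior
`witness a` on `ℤ⁴` has ALL exterior plaquettes (labels not meeting `C = {0,1}⁴`) within squared chord
`2 − 2cos a = ‖1 − D(a)‖²` of `1`, yet EVERY configuration agreeing with it off the 32 fibre links of `C` has a
genuine plaquette (`i < j`) meeting `C` of squared chord `≥ 2 − 2cos(2a) = ‖1 − D(2a)‖²`. -/
theorem smallField_extension_nogo {a : ℝ} (ha₀ : 0 ≤ a) (ha : a ≤ Real.pi / 4) :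
    (∀ p : Plaq 4, p ∉ meetsCube → csq (ZdGaugeConfig.plaquette (witness a) p.1 p.2.1 p.2.2) ≤ 2 - 2 * Real.cos a) ∧
    ∀ U : ZdGaugeConfig 4 SU2, (∀ e, e ∉ fibre → U e = witness a e) →
      ∃ p : Plaq 4, p.2.1 < p.2.2 ∧ p ∈ meetsCube ∧
        2 - 2 * Real.cos (2 * a) ≤ csq (ZdGaugeConfig.plaquette U p.1 p.2.1 p.2.2) := by
  refine ⟨fun p hp => csq_plaquette_witness_le a p.1 p.2.1 p.2.2 hp, fun U hU => ?_⟩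
  rcases le_max_iff.1 (le_max_csq_P₁_P₂ ha₀ ha hU) with h | h
  · exact ⟨P₁, P₁_P₂_mem_meetsCube.1.1, P₁_P₂_mem_meetsCube.1.2, h⟩
  · exact ⟨P₂, P₁_P₂_mem_meetsCube.2.1, P₁_P₂_mem_meetsCube.2.2, h⟩

/-- **THE PH-c FIBRE SET IS EMPTY.** For every threshold `2 − 2cos a < t ≤ 2 − 2cos(2a)` (squared chords) the
witness exterior is admissible WITH MARGIN (all exterior plaquettes `< t`), and NO completion makes every
genuine plaquette meeting `C` smaller than `t`. -/
theorem smallField_fibreSet_eq_empty {a t : ℝ} (ha₀ : 0 ≤ a) (ha : a ≤ Real.pi / 4)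
    (ht₁ : 2 - 2 * Real.cos a < t) (ht₂ : t ≤ 2 - 2 * Real.cos (2 * a)) :
    (∀ p : Plaq 4, p ∉ meetsCube → csq (ZdGaugeConfig.plaquette (witness a) p.1 p.2.1 p.2.2) < t) ∧
    {U : ZdGaugeConfig 4 SU2 | (∀ e, e ∉ fibre → U e = witness a e) ∧
        ∀ p : Plaq 4, p.2.1 < p.2.2 → p ∈ meetsCube → csq (ZdGaugeConfig.plaquette U p.1 p.2.1 p.2.2) < t} = ∅ := by
  obtain ⟨hext, hint⟩ := smallField_extension_nogo ha₀ ha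
  refine ⟨fun p hp => (hext p hp).trans_lt ht₁, Set.eq_empty_iff_forall_notMem.2 fun U hU => ?_⟩
  obtain ⟨p, hlt, hm, hge⟩ := hint U hU.1
  exact absurd (hU.2 p hlt hm) (not_lt.2 (ht₂.trans hge))

/-- The fibre space of PH-c: an `SU(2)` element on each fibre link. -/
abbrev FibreSpace : Type := ↥fibre → SU2

open Classical in
/-- Gluing a fibre `V` into the witness exterior. -/
def glue (a : ℝ) (V : FibreSpace) : ZdGaugeConfig 4 SU2 :=
  fun e => if h : e ∈ fibre then V ⟨e, h⟩ else witness a e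

/-- `glue a V` agrees with the witness off the fibre. -/
theorem glue_of_not_mem (a : ℝ) (V : FibreSpace) {e : ZdEdge 4} (he : e ∉ fibre) : glue a V e = witness a e := by
  simp [glue, he]

/-- The PH-c event at threshold `t` (squared chord): the fibres `V` whose glued configuration has every genuine
plaquette meeting `C` below `t`. -/
def smallFieldEvent (a t : ℝ) : Set FibreSpace :=
  {V | ∀ p : Plaq 4, p.2.1 < p.2.2 → p ∈ meetsCube → csq (ZdGaugeConfig.plaquette (glue a V) p.1 p.2.1 p.2.2) < t}

/-- **HAAR VOLUME ZERO.** For all thresholds `2 − 2cos a < t ≤ 2 − 2cos(2a)` (for which every exterior plaquette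
of the witness is `< t`, `smallField_fibreSet_eq_empty`) the PH-c event is EMPTY, hence NULL for EVERY measure
on the fibre space (product Haar included) — not of volume `≥ (c·ε³)^{#links(C)}`. -/
theorem measure_smallFieldEvent_eq_zero {a t : ℝ} (ha₀ : 0 ≤ a) (ha : a ≤ Real.pi / 4)
    (ht₁ : 2 - 2 * Real.cos a < t) (ht₂ : t ≤ 2 - 2 * Real.cos (2 * a))
    {_m : MeasurableSpace FibreSpace} (μ : Measure FibreSpace) :
    smallFieldEvent a t = ∅ ∧ μ (smallFieldEvent a t) = 0 := by
  have hV : smallFieldEvent a t = ∅ := by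
    refine Set.eq_empty_iff_forall_notMem.2 fun V hV => ?_
    have hmem : glue a V ∈ {U : ZdGaugeConfig 4 SU2 | (∀ e, e ∉ fibre → U e = witness a e) ∧
        ∀ p : Plaq 4, p.2.1 < p.2.2 → p ∈ meetsCube → csq (ZdGaugeConfig.plaquette U p.1 p.2.1 p.2.2) < t} :=
      ⟨fun e he => glue_of_not_mem a V he, hV⟩
    rw [(smallField_fibreSet_eq_empty ha₀ ha ht₁ ht₂).2] at hmem
    exact hmem
  exact ⟨hV, by rw [hV, measure_empty]⟩

/-- **`ε`-FORM.** For every threshold `0 < ε ≤ √2` on the chord `‖1 − U(∂p)‖` there is an exterior on `ℤ⁴` all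
of whose exterior plaquettes have squared chord `≤ (3/10)ε²` (chord `< 0.548ε`: admissible with a 45 % margin)
such that EVERY completion on the fibre links of `C` has a genuine plaquette meeting `C` of squared chord `≥ ε²`
(`a = arcsin(ε/2)`: `2 − 2cos 2a = ε²`, `2 − 2cos a = ε²/(2 + 2cos a) ≤ ε²/(2 + √2)`). -/
theorem smallField_extension_nogo_eps {ε : ℝ} (hε₀ : 0 < ε) (hε : ε ≤ Real.sqrt 2) :
    ∃ U₀ : ZdGaugeConfig 4 SU2,
      (∀ p : Plaq 4, p ∉ meetsCube → csq (ZdGaugeConfig.plaquette U₀ p.1 p.2.1 p.2.2) ≤ 3 / 10 * ε ^ 2) ∧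
      ∀ U : ZdGaugeConfig 4 SU2, (∀ e, e ∉ fibre → U e = U₀ e) →
        ∃ p : Plaq 4, p.2.1 < p.2.2 ∧ p ∈ meetsCube ∧ ε ^ 2 ≤ csq (ZdGaugeConfig.plaquette U p.1 p.2.1 p.2.2) := by
  have hsqrt2 : Real.sqrt 2 < 2 := (Real.sqrt_lt' (by norm_num)).2 (by norm_num)
  have h43 : (4 : ℝ) / 3 ≤ Real.sqrt 2 := (Real.le_sqrt' (by norm_num)).2 (by norm_num)
  have hε2 : ε / 2 ≤ 1 := by linarith
  have hε2' : -1 ≤ ε / 2 := by linarith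
  set a := Real.arcsin (ε / 2) with ha_def
  have hsin : Real.sin a = ε / 2 := Real.sin_arcsin hε2' hε2
  have ha₀ : 0 ≤ a := Real.arcsin_nonneg.2 (by linarith)
  have ha : a ≤ Real.pi / 4 := by
    rw [ha_def, Real.arcsin_le_iff_le_sin ⟨hε2', hε2⟩ ⟨by linarith [Real.pi_pos], by linarith [Real.pi_pos]⟩,
      Real.sin_pi_div_four]
    linarith
  have hp := Real.sin_sq_add_cos_sq a
  have hcos2 : 2 - 2 * Real.cos (2 * a) = ε ^ 2 := by
    rw [Real.cos_two_mul]
    linear_combination (-4) * hp + (4 * Real.sin a + 2 * ε) * hsin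
  have hcosa : Real.sqrt 2 / 2 ≤ Real.cos a := by
    rw [← Real.cos_pi_div_four]
    exact Real.cos_le_cos_of_nonneg_of_le_pi ha₀ (by linarith [Real.pi_pos]) ha
  have hprod : (2 - 2 * Real.cos a) * (2 + 2 * Real.cos a) = ε ^ 2 := by
    linear_combination (-4) * hp + (4 * Real.sin a + 2 * ε) * hsin
  have hnn : 0 ≤ 2 - 2 * Real.cos a := by linarith [Real.cos_le_one a]
  have hden : 10 / 3 ≤ 2 + 2 * Real.cos a := by linarith
  have hext : 2 - 2 * Real.cos a ≤ 3 / 10 * ε ^ 2 := by nlinarith [mul_le_mul_of_nonneg_left hden hnn]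
  obtain ⟨h1, h2⟩ := smallField_extension_nogo ha₀ ha
  refine ⟨witness a, fun p hp => (h1 p hp).trans hext, fun U hU => ?_⟩
  obtain ⟨p, hlt, hm, hge⟩ := h2 U hU
  exact ⟨p, hlt, hm, hcos2 ▸ hge⟩

end Summit.QuantumFields.BalabanUV.T4Continuum.NE7b.SmallFieldExtensionNoGo
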